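import Summits.HodgeConjecture.HodgeConjecture.Theorems.Q8SymplecticPowersStubDegreeTwoCore
import Summits.HodgeConjecture.HodgeConjecture.Theorems.Q8SymplecticPowersSquare
import Summits.HodgeConjecture.HodgeConjecture.Theorems.Q8SymplecticPowersStubHigherPowersQ
import Summits.HodgeConjecture.HodgeConjecture.Theses.Q8SymplecticPowers
import HarnessLib

/-!
# Route `Q8SymplecticPowers`, crux K2Q `PowersHodgeOfQuaternionCommutators` (stmt-HodgeConjecture-24191) — CLOSING COMPOSITION

The registered birth skeleton `Cruxes/PowersHodgeOfQuaternionCommutators/Lines/birth.lean` (sha16 `c8972cf19c5fdbbf`,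
planner hodge-nonav-p3) of the crux
`Summit.HodgeConjecture.HodgeConjecture.Theses.Q8SymplecticPowers.PowersHodgeOfQuaternionCommutators` has all three stubs
landed BY NAME under `Theorems/`:

* `stub_q8CommutatorDegreeTwoCore` (`Q8SymplecticPowersStubDegreeTwoCore`, the degree-2 ENGINE);
* `stub_squareQ` (`Q8SymplecticPowersSquare`, p714819: `HC(X)` and `HC(X × X)`, `k ≤ 1`);
* `stub_higherPowersQ` (`Q8SymplecticPowersStubHigherPowersQ`, p722734: all fibre powers, via the Künneth–Hodge normal form,
  the `Comm` clause, the symplectic-quaternionic first fundamental theorem over `ℚ` and the algebraicity of projected graph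
  Casimir matchings).

This file is the skeleton's kernel-checked composition `PowersHodgeOfQuaternionCommutators_of` with the landed theorems
substituted: **`powersHodgeOfQuaternionCommutators`** proves the crux BY NAME.  No new mathematics.  Prover seat
`hodge-nonav-20241-p1` (g21).

HONEST FRAMING: axioms standard; this proves the route decl `PowersHodgeOfQuaternionCommutators` (crux K2Q of route
`Q8SymplecticPowers`: HC for the self fibre powers of a surface carrying a cohomological quaternion deck pair whose
quaternionic-unitary commutators lie in the Hodge group); the route's other cruxes (K1Q `VeryGeneralQuaternionCommutatorsInHg`,
…) are untouched; nothing here says HC ∕ HC_CM ∕ HC_AV is proved.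

## References

* R. Goodman, N. Wallach, *Symmetry, Representations, and Invariants*, GTM 255, §5.3.2. [cite: GoodmanWallachGTM255]
* C. Voisin, *Hodge Theory and Complex Algebraic Geometry I* (2002), §11.3.3. [cite: VoisinHodgeI2002]
-/

set_option linter.dupNamespace false

noncomputable section

namespace Summit.HodgeConjecture.HodgeConjecture.Theorems.Q8SymplecticPowersPowersHodgeOfQuaternionCommutators

/-- **Crux K2Q `PowersHodgeOfQuaternionCommutators` (stmt-HodgeConjecture-24191)**, the registered skeleton's composition of
its three landed stubs. [cite: GoodmanWallachGTM255, §5.3.2 Thm. 5.3.3] [cite: VoisinHodgeI2002, §11.3.3 Thm. 11.38–11.41] -/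
theorem powersHodgeOfQuaternionCommutators :
    Summit.HodgeConjecture.HodgeConjecture.Theses.Q8SymplecticPowers.PowersHodgeOfQuaternionCommutators := by
  have h₀ := @Q8SymplecticPowersStubDegreeTwoCore.stub_q8CommutatorDegreeTwoCore
  have h₁ := @Q8SymplecticPowersSquare.stub_squareQ
  have h₂ := @Q8SymplecticPowersStubHigherPowersQ.stub_higherPowersQ
  intro X hX hb1 τ j hdeck hcomm k Y hY
  by_cases hk : k ≤ 1
  · exact h₁ h₀ hX hb1 τ j hdeck hcomm hk hY
  · exact h₂ hX hb1 τ j hdeck hcomm (fun k' Y' hk' hY' => h₁ h₀ hX hb1 τ j hdeck hcomm hk' hY') (by omega) hY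

end Summit.HodgeConjecture.HodgeConjecture.Theorems.Q8SymplecticPowersPowersHodgeOfQuaternionCommutators

end
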